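import Summits.CriticalPhenomena.PercolationContinuityZ3.Theorems.PercNearOneGluingNoHeavyLowerTailWorstPairExchangeCex
import HarnessLib

/-!
# `NoHeavyLowerTail` (stmt-CriticalPhenomena-4575) — k-cluster line: the conditional positive association of a cluster
# (BHK 2006, Thm. 1.2/1.3) does NOT survive the separation of the other clusters among themselves (certified 6-vertex witness)

Support file (prover `prim-hp-7`, hull-port prover #7, technique "k-cluster conditional association"; `--supports
stmt-CriticalPhenomena-4575`).  Computational (`native_decide` on 1024-term exact rational sums, as in
`PercNearOneGluingNoHeavyLowerTailThreeClusterNegCorrCex.lean`, whose evaluation pattern it repeats on `Fin 6`).  No definitions, no named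
facts, no sorries.

**Background.**  [VandenbergHaggstromKahn2005, Thm. 1.2 (p. 5)]: for a vertex `s`, a set `X ∌ s` and increasing events `A, B` determined by
the open cluster `C_s`, `Pr(A B | s ↮ X) ≥ Pr(A | s ↮ X) Pr(B | s ↮ X)` (tree: `BHK2006_clusterConditionalPositiveAssociation`, PROVED in
`ConditionalPositiveAssociationProofs.lean`).  With `X = {t, u}` the vertices `t, u` may lie in one cluster or in two.  The natural "k = 3"
strengthening — condition on `s, t, u` lying in THREE different clusters — was the first positive candidate of the k-cluster line (seat memo
run/shared/lean/prim/prim-hp-7/HP7-K3-INVENTORY.md, K3-A; 0 violations in ≈2·10⁴ random exact instances n ≤ 7 with weights < 0.95).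

**This file: it is false.**  Adversarial climbs with near-glued pairs find violations (only) in the corner where `D₃` is rare.  Witness:
`Fin 6`, `s = 0`, `t = 1`, `u = 2`, `a = 3`, `b = 4`, auxiliary vertex `5`; weights `w(0,1) = 3/10`, `w(0,2) = 7/10`,
`w(0,3) = w(0,4) = w(1,4) = w(1,5) = w(2,3) = w(2,5) = 19/20`, `w(3,5) = w(4,5) = 7/10`, all other pairs `0`.  With
`D₃ = {0 ↮ 1} ∩ {0 ↮ 2} ∩ {1 ↮ 2}`:  `μ(D₃) = 27510357/6.4·10¹¹ ≈ 4.30·10⁻⁵`, `μ(D₃ ∩ {0↔3}) = μ(D₃ ∩ {0↔4}) = 1973853/1.28·10¹¹`,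
`μ(D₃ ∩ {0↔3} ∩ {0↔4}) = 211869/4·10¹⁰`, and `μ(D₃)·μ(D₃ ∩ {0↔3} ∩ {0↔4}) ≈ 2.2768·10⁻¹⁰ < μ(D₃ ∩ {0↔3})·μ(D₃ ∩ {0↔4}) ≈ 2.3780·10⁻¹⁰`
(conditionally on `D₃`: `P(0↔3, 0↔4) = 0.1232 < P(0↔3)P(0↔4) = 0.1287`).  Mechanism: `a = 3` is nearly glued to `u = 2` and `b = 4` to `t = 1`;
on `D₃` the event `{0 ↔ 3}` forces the pair `2–3` closed and `{0 ↔ 4}` forces `1–4` closed, and the two requirements compete through the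
auxiliary vertex `5` (paths `3–5–2`, `4–5–1` must also be blocked), an "explaining-away" that the two-cluster conditioning `{s ↮ X}` does not have.

Companion: `PercNearOneGluingNoHeavyLowerTailThreeClusterNegCorrCex.lean` (the cross-cluster NEGATIVE correlation, Thm. 1.4, also fails under a
third separated cluster).  Together: neither half of BHK's two-cluster picture survives conditioning on three mutually separated clusters; the
tripod exchange (C⁺) with a two-sided guard is the only three-cluster cell of the seat's inventory without a known violation.

* `ThreeClusterCPACex.real_D3_inter` — evaluation of `μ(D₃ ∩ E)` (`Fin 6`) for any event given by a `Bool` test on reach tables;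
* `ThreeClusterCPACex.violation_of_check` — one decidable rational fact ⇒ the violating instance;
* `threeClusterCPA_cex` — the instance;  `threeClusterCPA_false` — `¬`(Thm. 1.2 with the three-way separation), all finite weighted graphs.
-/

namespace Summit.CriticalPhenomena.PercolationContinuityZ3.Theorems

open MeasureTheory
open Literature.Probability.LatticeModels Literature.Probability.Percolation
open Summit.CriticalPhenomena.PercolationContinuityZ3.Theorems.AdditiveGluing.Negative.Cert

namespace ThreeClusterCPACex

open WorstPairExchangeCex (real_eq_wcount)

/-- **Evaluation of `μ(D₃ ∩ E)` on `Fin 6`.**  For a weighted edge list `l` (distinct pairs, weights in `[0,1]`) and an event `E`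
whose per-configuration indicator is the `Bool` test `f` on the reach table, `μ(D₃ ∩ E)` is the exact weighted count of
`(test of D₃) && f`, `D₃ = {0 ↮ 1} ∩ {0 ↮ 2} ∩ {1 ↮ 2}`. [this file] -/
theorem real_D3_inter {l : List (Fin 6 × Fin 6 × ℚ)} (hnd : (wPairs l).Nodup)
    (hq : ∀ e ∈ l, 0 ≤ e.2.2 ∧ e.2.2 ≤ 1) (f : List ℕ → Bool) (E : Set (BondConfig (Fin 6)))
    (hfE : ∀ ω : List (Fin 6 × Fin 6), f (reachTable 6 ω) = true ↔ (↑(Eset ω) : Set (Sym2 (Fin 6))) ∈ E) :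
    (prodBernoulli (wOfList l)).real
        ((openConn (0 : Fin 6) (1 : Fin 6) : Set (BondConfig (Fin 6)))ᶜ ∩ (openConn (0 : Fin 6) (2 : Fin 6))ᶜ ∩
          (openConn (1 : Fin 6) (2 : Fin 6))ᶜ ∩ E) =
      ((((wtabs 6 l).map fun t => if ((!(t.1.getD 0 0).testBit 1 && !(t.1.getD 0 0).testBit 2 && !(t.1.getD 1 0).testBit 2) && f t.1) then t.2 else 0).sum : ℚ) : ℝ) := by
  refine real_eq_wcount hnd hq (fun tb => (!(tb.getD 0 0).testBit 1 && !(tb.getD 0 0).testBit 2 && !(tb.getD 1 0).testBit 2) && f tb) _ fun ω => ?_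
  have h01 : ((reachTable 6 ω).getD 0 0).testBit 1 = true ↔
      (↑(Eset ω) : Set (Sym2 (Fin 6))) ∈ openConn (0 : Fin 6) (1 : Fin 6) :=
    testBit_reachTable_iff_mem_openConn ω (0 : Fin 6) (1 : Fin 6)
  have h02 : ((reachTable 6 ω).getD 0 0).testBit 2 = true ↔
      (↑(Eset ω) : Set (Sym2 (Fin 6))) ∈ openConn (0 : Fin 6) (2 : Fin 6) :=
    testBit_reachTable_iff_mem_openConn ω (0 : Fin 6) (2 : Fin 6)
  have h12 : ((reachTable 6 ω).getD 1 0).testBit 2 = true ↔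
      (↑(Eset ω) : Set (Sym2 (Fin 6))) ∈ openConn (1 : Fin 6) (2 : Fin 6) :=
    testBit_reachTable_iff_mem_openConn ω (1 : Fin 6) (2 : Fin 6)
  have hf := hfE ω
  simp only [Bool.and_eq_true, Bool.not_eq_true', Set.mem_inter_iff, Set.mem_compl_iff]
  constructor
  · rintro ⟨⟨⟨h1, h2⟩, h3⟩, h4⟩
    refine ⟨⟨⟨fun h => ?_, fun h => ?_⟩, fun h => ?_⟩, hf.1 h4⟩
    · rw [← h01] at h; rw [h] at h1; exact Bool.noConfusion h1
    · rw [← h02] at h; rw [h] at h2; exact Bool.noConfusion h2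
    · rw [← h12] at h; rw [h] at h3; exact Bool.noConfusion h3
  · rintro ⟨⟨⟨h1, h2⟩, h3⟩, h4⟩
    refine ⟨⟨⟨?_, ?_⟩, ?_⟩, hf.2 h4⟩
    · cases h : ((reachTable 6 ω).getD 0 0).testBit 1
      · rfl
      · exact absurd (h01.1 h) h1
    · cases h : ((reachTable 6 ω).getD 0 0).testBit 2
      · rfl
      · exact absurd (h02.1 h) h2
    · cases h : ((reachTable 6 ω).getD 1 0).testBit 2
      · rfl
      · exact absurd (h12.1 h) h3

/-- `μ(D₃)` as an exact weighted count. [this file] -/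
theorem real_D3 {l : List (Fin 6 × Fin 6 × ℚ)} (hnd : (wPairs l).Nodup) (hq : ∀ e ∈ l, 0 ≤ e.2.2 ∧ e.2.2 ≤ 1) :
    (prodBernoulli (wOfList l)).real
        ((openConn (0 : Fin 6) (1 : Fin 6) : Set (BondConfig (Fin 6)))ᶜ ∩ (openConn (0 : Fin 6) (2 : Fin 6))ᶜ ∩
          (openConn (1 : Fin 6) (2 : Fin 6))ᶜ) =
      ((((wtabs 6 l).map fun t => if ((!(t.1.getD 0 0).testBit 1 && !(t.1.getD 0 0).testBit 2 && !(t.1.getD 1 0).testBit 2) && true) then t.2 else 0).sum : ℚ) : ℝ) := by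
  have key := real_D3_inter hnd hq (fun _ => true) Set.univ (fun ω => by simp)
  rwa [Set.inter_univ] at key

/-- `μ(D₃ ∩ {0 ↔ 3})` as an exact weighted count. [this file] -/
theorem real_D3_sa {l : List (Fin 6 × Fin 6 × ℚ)} (hnd : (wPairs l).Nodup) (hq : ∀ e ∈ l, 0 ≤ e.2.2 ∧ e.2.2 ≤ 1) :
    (prodBernoulli (wOfList l)).real
        ((openConn (0 : Fin 6) (1 : Fin 6) : Set (BondConfig (Fin 6)))ᶜ ∩ (openConn (0 : Fin 6) (2 : Fin 6))ᶜ ∩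
          (openConn (1 : Fin 6) (2 : Fin 6))ᶜ ∩ openConn (0 : Fin 6) (3 : Fin 6)) =
      ((((wtabs 6 l).map fun t => if ((!(t.1.getD 0 0).testBit 1 && !(t.1.getD 0 0).testBit 2 && !(t.1.getD 1 0).testBit 2) && (t.1.getD 0 0).testBit 3) then t.2 else 0).sum : ℚ) : ℝ) :=
  real_D3_inter hnd hq (fun tb => (tb.getD 0 0).testBit 3) _
    (fun ω => testBit_reachTable_iff_mem_openConn ω (0 : Fin 6) (3 : Fin 6))

/-- `μ(D₃ ∩ {0 ↔ 4})` as an exact weighted count. [this file] -/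
theorem real_D3_sb {l : List (Fin 6 × Fin 6 × ℚ)} (hnd : (wPairs l).Nodup) (hq : ∀ e ∈ l, 0 ≤ e.2.2 ∧ e.2.2 ≤ 1) :
    (prodBernoulli (wOfList l)).real
        ((openConn (0 : Fin 6) (1 : Fin 6) : Set (BondConfig (Fin 6)))ᶜ ∩ (openConn (0 : Fin 6) (2 : Fin 6))ᶜ ∩
          (openConn (1 : Fin 6) (2 : Fin 6))ᶜ ∩ openConn (0 : Fin 6) (4 : Fin 6)) =
      ((((wtabs 6 l).map fun t => if ((!(t.1.getD 0 0).testBit 1 && !(t.1.getD 0 0).testBit 2 && !(t.1.getD 1 0).testBit 2) && (t.1.getD 0 0).testBit 4) then t.2 else 0).sum : ℚ) : ℝ) :=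
  real_D3_inter hnd hq (fun tb => (tb.getD 0 0).testBit 4) _
    (fun ω => testBit_reachTable_iff_mem_openConn ω (0 : Fin 6) (4 : Fin 6))

/-- `μ(D₃ ∩ ({0 ↔ 3} ∩ {0 ↔ 4}))` as an exact weighted count. [this file] -/
theorem real_D3_sa_sb {l : List (Fin 6 × Fin 6 × ℚ)} (hnd : (wPairs l).Nodup)
    (hq : ∀ e ∈ l, 0 ≤ e.2.2 ∧ e.2.2 ≤ 1) :
    (prodBernoulli (wOfList l)).real
        ((openConn (0 : Fin 6) (1 : Fin 6) : Set (BondConfig (Fin 6)))ᶜ ∩ (openConn (0 : Fin 6) (2 : Fin 6))ᶜ ∩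
          (openConn (1 : Fin 6) (2 : Fin 6))ᶜ ∩ (openConn (0 : Fin 6) (3 : Fin 6) ∩ openConn (0 : Fin 6) (4 : Fin 6))) =
      ((((wtabs 6 l).map fun t =>
          if ((!(t.1.getD 0 0).testBit 1 && !(t.1.getD 0 0).testBit 2 && !(t.1.getD 1 0).testBit 2) && ((t.1.getD 0 0).testBit 3 && (t.1.getD 0 0).testBit 4)) then t.2 else 0).sum : ℚ) : ℝ) :=
  real_D3_inter hnd hq (fun tb => (tb.getD 0 0).testBit 3 && (tb.getD 0 0).testBit 4) _ (fun ω => by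
    have h03 : ((reachTable 6 ω).getD 0 0).testBit 3 = true ↔
        (↑(Eset ω) : Set (Sym2 (Fin 6))) ∈ openConn (0 : Fin 6) (3 : Fin 6) :=
      testBit_reachTable_iff_mem_openConn ω (0 : Fin 6) (3 : Fin 6)
    have h14 : ((reachTable 6 ω).getD 0 0).testBit 4 = true ↔
        (↑(Eset ω) : Set (Sym2 (Fin 6))) ∈ openConn (0 : Fin 6) (4 : Fin 6) :=
      testBit_reachTable_iff_mem_openConn ω (0 : Fin 6) (4 : Fin 6)
    rw [Bool.and_eq_true, Set.mem_inter_iff]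
    exact Iff.and h03 h14)

/-- **From one checkable rational fact to the violating instance.**  If the exact counts satisfy
`count(D₃) · count(D₃, 0↔3, 0↔4) < count(D₃, 0↔3) · count(D₃, 0↔4)` then under `prodBernoulli (wOfList l)` the two
connection events OF THE SAME CLUSTER `C_0` are strictly NEGATIVELY correlated given `D₃`. [this file] -/
theorem violation_of_check (l : List (Fin 6 × Fin 6 × ℚ)) (hnd : (wPairs l).Nodup)
    (hq : ∀ e ∈ l, 0 ≤ e.2.2 ∧ e.2.2 ≤ 1)
    (hlt : ((wtabs 6 l).map fun t => if ((!(t.1.getD 0 0).testBit 1 && !(t.1.getD 0 0).testBit 2 && !(t.1.getD 1 0).testBit 2) && true) then t.2 else 0).sum *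
        ((wtabs 6 l).map fun t =>
          if ((!(t.1.getD 0 0).testBit 1 && !(t.1.getD 0 0).testBit 2 && !(t.1.getD 1 0).testBit 2) && ((t.1.getD 0 0).testBit 3 && (t.1.getD 0 0).testBit 4)) then t.2 else 0).sum <
      ((wtabs 6 l).map fun t => if ((!(t.1.getD 0 0).testBit 1 && !(t.1.getD 0 0).testBit 2 && !(t.1.getD 1 0).testBit 2) && (t.1.getD 0 0).testBit 3) then t.2 else 0).sum *
        ((wtabs 6 l).map fun t => if ((!(t.1.getD 0 0).testBit 1 && !(t.1.getD 0 0).testBit 2 && !(t.1.getD 1 0).testBit 2) && (t.1.getD 0 0).testBit 4) then t.2 else 0).sum) :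
    (prodBernoulli (wOfList l)).real
        ((openConn (0 : Fin 6) (1 : Fin 6) : Set (BondConfig (Fin 6)))ᶜ ∩ (openConn (0 : Fin 6) (2 : Fin 6))ᶜ ∩
          (openConn (1 : Fin 6) (2 : Fin 6))ᶜ) *
      (prodBernoulli (wOfList l)).real
        ((openConn (0 : Fin 6) (1 : Fin 6) : Set (BondConfig (Fin 6)))ᶜ ∩ (openConn (0 : Fin 6) (2 : Fin 6))ᶜ ∩
          (openConn (1 : Fin 6) (2 : Fin 6))ᶜ ∩ (openConn (0 : Fin 6) (3 : Fin 6) ∩ openConn (0 : Fin 6) (4 : Fin 6))) <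
    (prodBernoulli (wOfList l)).real
        ((openConn (0 : Fin 6) (1 : Fin 6) : Set (BondConfig (Fin 6)))ᶜ ∩ (openConn (0 : Fin 6) (2 : Fin 6))ᶜ ∩
          (openConn (1 : Fin 6) (2 : Fin 6))ᶜ ∩ openConn (0 : Fin 6) (3 : Fin 6)) *
      (prodBernoulli (wOfList l)).real
        ((openConn (0 : Fin 6) (1 : Fin 6) : Set (BondConfig (Fin 6)))ᶜ ∩ (openConn (0 : Fin 6) (2 : Fin 6))ᶜ ∩
          (openConn (1 : Fin 6) (2 : Fin 6))ᶜ ∩ openConn (0 : Fin 6) (4 : Fin 6)) := by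
  rw [real_D3_sa hnd hq, real_D3_sb hnd hq, real_D3 hnd hq, real_D3_sa_sb hnd hq]
  exact_mod_cast hlt

end ThreeClusterCPACex

open ThreeClusterCPACex in
/-- **Clique separation does NOT keep the cluster associated: the instance.**  There is a weight function `w` on the pairs of
`Fin 6` — `w(0,1) = 3/10`, `w(0,2) = 7/10`, `w(0,3) = w(0,4) = w(1,4) = w(1,5) = w(2,3) = w(2,5) = 19/20`, `w(3,5) = w(4,5) = 7/10`, all other pairs
`0` — such that for `μ = prodBernoulli w` and `D₃ = {0 ↮ 1} ∩ {0 ↮ 2} ∩ {1 ↮ 2}` the two INCREASING events `{0 ↔ 3}`, `{0 ↔ 4}` of the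
cluster of `0` are strictly negatively correlated given `D₃`:
`μ(D₃) · μ(D₃ ∩ {0↔3} ∩ {0↔4}) < μ(D₃ ∩ {0↔3}) · μ(D₃ ∩ {0↔4})`
(`5828591827233/(2.56·10²²) < 3896095665609/(1.6384·10²²)`; conditionally `0.1232 < 0.1287`; exact rationals by `native_decide`). [this file] -/
theorem threeClusterCPA_cex : ∃ w : Sym2 (Fin 6) → unitInterval,
    (prodBernoulli w).real
        ((openConn (0 : Fin 6) (1 : Fin 6) : Set (BondConfig (Fin 6)))ᶜ ∩ (openConn (0 : Fin 6) (2 : Fin 6))ᶜ ∩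
          (openConn (1 : Fin 6) (2 : Fin 6))ᶜ) *
      (prodBernoulli w).real
        ((openConn (0 : Fin 6) (1 : Fin 6) : Set (BondConfig (Fin 6)))ᶜ ∩ (openConn (0 : Fin 6) (2 : Fin 6))ᶜ ∩
          (openConn (1 : Fin 6) (2 : Fin 6))ᶜ ∩ (openConn (0 : Fin 6) (3 : Fin 6) ∩ openConn (0 : Fin 6) (4 : Fin 6))) <
    (prodBernoulli w).real
        ((openConn (0 : Fin 6) (1 : Fin 6) : Set (BondConfig (Fin 6)))ᶜ ∩ (openConn (0 : Fin 6) (2 : Fin 6))ᶜ ∩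
          (openConn (1 : Fin 6) (2 : Fin 6))ᶜ ∩ openConn (0 : Fin 6) (3 : Fin 6)) *
      (prodBernoulli w).real
        ((openConn (0 : Fin 6) (1 : Fin 6) : Set (BondConfig (Fin 6)))ᶜ ∩ (openConn (0 : Fin 6) (2 : Fin 6))ᶜ ∩
          (openConn (1 : Fin 6) (2 : Fin 6))ᶜ ∩ openConn (0 : Fin 6) (4 : Fin 6)) :=
  ⟨_, violation_of_check
    [(0, 1, 3/10), (0, 2, 7/10), (0, 3, 19/20), (0, 4, 19/20), (1, 4, 19/20), (1, 5, 19/20), (2, 3, 19/20), (2, 5, 19/20),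
      (3, 5, 7/10), (4, 5, 7/10)] (by decide)
    (by
      intro e he
      simp only [List.mem_cons, List.not_mem_nil, or_false] at he
      rcases he with rfl | rfl | rfl | rfl | rfl | rfl | rfl | rfl | rfl | rfl <;> norm_num)
    (by native_decide)⟩

/-- **No-go for the k-cluster line: van den Berg–Häggström–Kahn's conditional positive association of the cluster `C_s` given
`{s ↮ X}` (Thm. 1.2/1.3, tree `BHK2006_clusterConditionalPositiveAssociation`) does NOT survive the additional separation of the
OTHER vertices among themselves.**  It is false that for every finite weighted graph and all pairwise distinct `s, t, u, a, b`, with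
`D₃ = {s ↮ t} ∩ {s ↮ u} ∩ {t ↮ u}` ("`s, t, u` in three different clusters"),
`μ(D₃) · μ(D₃ ∩ {s↔a} ∩ {s↔b}) ≥ μ(D₃ ∩ {s↔a}) · μ(D₃ ∩ {s↔b})`.
Witness `threeClusterCPA_cex` (`n = 6`, `(s,t,u,a,b) = (0,1,2,3,4)`; all exact violations found live in the near-glued corner,
weights `≥ 19/20`, `μ(D₃) ≈ 4·10⁻⁵`). [this file] -/
theorem threeClusterCPA_false :
    ¬ (∀ (n : ℕ) (w : Sym2 (Fin n) → unitInterval) (s t u a b : Fin n), [s, t, u, a, b].Nodup →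
      (prodBernoulli w).real ((openConn s t : Set (BondConfig (Fin n)))ᶜ ∩ (openConn s u)ᶜ ∩ (openConn t u)ᶜ ∩ openConn s a) *
        (prodBernoulli w).real ((openConn s t : Set (BondConfig (Fin n)))ᶜ ∩ (openConn s u)ᶜ ∩ (openConn t u)ᶜ ∩ openConn s b) ≤
      (prodBernoulli w).real ((openConn s t : Set (BondConfig (Fin n)))ᶜ ∩ (openConn s u)ᶜ ∩ (openConn t u)ᶜ) *
        (prodBernoulli w).real
          ((openConn s t : Set (BondConfig (Fin n)))ᶜ ∩ (openConn s u)ᶜ ∩ (openConn t u)ᶜ ∩ (openConn s a ∩ openConn s b))) := by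
  intro h
  obtain ⟨w, hgt⟩ := threeClusterCPA_cex
  have hle := h 6 w 0 1 2 3 4 (by decide)
  exact absurd hle (not_le.2 hgt)

end Summit.CriticalPhenomena.PercolationContinuityZ3.Theorems
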